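import Literature.Probability.RandomPlanarGeometry.ArcHullSlits
import Literature.Probability.RandomPlanarGeometry.PlusHullDisplacement
import Literature.Probability.RandomPlanarGeometry.LSWClosedConvergesDiagonal
import HarnessLib

/-!
# [LSW] Lemma 3.5, density of `𝒜₀`: the smooth hulls `E_δ` from Loewner's theorem for SLITS

G. F. Lawler, O. Schramm, W. Werner, *Conformal restriction: the chordal case*, J. Amer. Math.
Soc. **16** (2003) 917–955, arXiv:math/0209343 (**[LSW]**), proof of Lemma 3.5, p. 13: the hull
`E_δ`, bounded by the simple path `β : [0, s] → ℍ̄`, is approximated by `𝒜₀` through the Loewner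
chain of `β` ("`g_t := g_{β[0,t]}` … By the chordal version of Loewner's theorem … `Φ^{(n)}_s(z) →
Φ_s(z) = Φ_{E_δ}` locally uniformly in `ℍ̄ ∖ E_δ`"). The tree's `RestrictionDensityLoewner` reduces
the named fact `IsArcHull.exists_isLSWGenerated_lswClosedConverges` (`RestrictionDensityArc`) to
Loewner's theorem for the boundary path INCLUDING its terminal time `s`, at which the path
returns to `ℝ` and the enclosed region is swallowed (`IsArcHull.exists_loewner_chain`: the hull at
the terminal time is `E_δ ∩ ℍ`). This file gives the alternative reduction which only needs
**Loewner's theorem for slits** — simple paths `γ : [0, u] → ℍ̄` with `γ(0) ∈ ℝ` and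
`γ(0, u] ⊆ ℍ` (G. F. Lawler, *Conformally Invariant Processes in the Plane* (2005), Prop. 4.4
with Thm. 4.6: the slit `γ[0, u]` is the closed hull `closure (K_S)` of the chordal Loewner chain
of a continuous driving function) — and never looks at the terminal time:

* `IsArcHull.lswClosedConverges_slit` — **the slits `β[0, u_n]`, `u_n ↑ 1`, converge to the
  smooth hull `A`** in the sense of [LSW] p. 12 on the closed half-plane (`LSWClosedConverges`):
  the kernel theorem `IsPlusHull.tendstoLocallyUniformlyOn_extMap_of_frontier` (`HullKernelLimit`)
  with the uniform displacement bound of `PlusHullDisplacement` and the slit facts of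
  `ArcHullSlits`;
* `IsArcHull.exists_isLSWGenerated_lswClosedConverges_of_slit` — **the named fact follows from
  Loewner's theorem for slits** (hypothesis `hslit`, spelled out): each slit is
  `closure (K_S)` for a continuous `W` with `W_0 = β(0) > 0`, hence an `LSWClosedConverges`-limit
  of `𝒜₀` by the Euler scheme `Loewner.exists_lswClosedConverges_closure_hull`
  (`RestrictionDensityLoewner`), and the diagonal principle
  `IsPlusHull.exists_lswClosedConverges_diagonal` (`LSWClosedConvergesDiagonal`) concludes.

## References

* [LSW] proof of Lemma 3.5, pp. 12–13 [LawlerSchrammWerner2003Restriction].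
* G. F. Lawler (2005), §4.1, Prop. 4.4, Thm. 4.6 [Lawler2005].
-/

noncomputable section

open Set Filter Metric Complex Bornology
open _root_.Topology
open UpperHalfPlane (upperHalfPlaneSet isOpen_upperHalfPlaneSet)
open scoped NNReal

namespace Literature.Probability.RandomPlanarGeometry

/-! ### The slits converge to the smooth hull -/

section SlitConvergence

variable {A : Set ℂ} (hA : IsArcHull A) (hAp : IsPlusHull A) {γ : ℝ → ℂ}
  (hγc : ContinuousOn γ (Icc 0 1)) (hγi : InjOn γ (Icc 0 1)) (h0 : (γ 0).im = 0)
  (hH : ∀ t ∈ Ioo (0 : ℝ) 1, 0 < (γ t).im) (hfr : upperHalfPlaneSet ∩ frontier A = γ '' Ioo 0 1)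
  {v : ℕ → ℝ} (hv0 : ∀ n, 0 < v n) (hv1 : ∀ n, v n < 1) (hvt : Tendsto v atTop (𝓝 1))
include hA hAp hγc hγi h0 hH hfr hv0 hv1 hvt

omit hγi h0 hH hv0 hv1 hvt in
/-- A compact subset of `ℍ̄` missing `A' = realFill A` lies in the symmetric domain `Ω_A`. [folklore] -/
theorem IsArcHull.subset_plusDomain_of_disjoint_realFill {S : Set ℂ} (hSH : S ⊆ closure upperHalfPlaneSet)
    (hSF : Disjoint S (realFill A)) : S ⊆ plusDomain A := by
  have hne : A.Nonempty := ⟨γ 0, hA.apply_zero_mem hγc hfr⟩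
  intro z hz
  have hzF : z ∉ realFill A := Set.disjoint_left.1 hSF hz
  have hzim : 0 ≤ z.im := by
    have := hSH hz
    rwa [show upperHalfPlaneSet = {z : ℂ | 0 < z.im} from rfl, closure_setOf_lt_im] at this
  rcases hzim.lt_or_eq with hpos | hzero
  · exact (hAp.mem_plusDomain_iff_of_im_pos hpos).2 fun h ↦ hzF (subset_realFill A h)
  · have hzre : ((z.re : ℝ) : ℂ) = z := Complex.ext (by simp) (by simp [hzero])
    rw [← hzre]
    refine (hAp.ofReal_mem_plusDomain_iff hne).2 ?_
    by_contra hcon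
    push Not at hcon
    exact hzF (by rw [← hzre, realFill_eq]; exact Or.inr ⟨z.re, ⟨hcon.1, hcon.2⟩, rfl⟩)

/-- **The slits `γ[0, v_n]`, `v_n ↑ 1`, converge to the smooth `+`-hull `A` on the closed
half-plane** ([LSW] p. 13, "`Φ_s = Φ_{E_δ}`" in "`ℍ̄ ∖ E_δ`"): `LSWClosedConverges A Φ` for the
restriction maps `Φ_{γ[0,v_n]}` and any restriction map `Φ` of `A`. (Kernel theorem + uniform
displacement `|E_{γ[0,v_n]} - id| ≤ 12r` + the slit facts.) [cite: LawlerSchrammWerner2003Restriction, proof of Lemma 3.5 (p. 13)] -/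
theorem IsArcHull.lswClosedConverges_slit {Φ : ConformalEquiv (upperHalfPlaneSet \ A) upperHalfPlaneSet}
    (hΦ : IsRestrictionMap A Φ) :
    LSWClosedConverges A Φ (fun n ↦ γ '' Icc 0 (v n))
      (fun n ↦ (hA.isPlusHull_slit hAp hγc hγi h0 hH hfr (hv0 n) (hv1 n)).baseMap
        ((nonempty_Icc.2 (hv0 n).le).image γ)) := by
  have hne : A.Nonempty := ⟨γ 0, hA.apply_zero_mem hγc hfr⟩
  set J : ℕ → Set ℂ := fun n ↦ γ '' Icc 0 (v n) with hJdef
  have hJ : ∀ n, IsPlusHull (J n) := fun n ↦ hA.isPlusHull_slit hAp hγc hγi h0 hH hfr (hv0 n) (hv1 n)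
  have hJne : ∀ n, (J n).Nonempty := fun n ↦ (nonempty_Icc.2 (hv0 n).le).image γ
  have hJsub : ∀ n, J n ⊆ A := fun n ↦ hA.slit_subset hγc hfr (hv1 n).le
  have hdom : ∀ n, plusDomain A ⊆ plusDomain (J n) := fun n ↦
    hA.plusDomain_subset_plusDomain_slit hγc h0 hH hfr (hv0 n).le (hv1 n)
  obtain ⟨r, hr, hball⟩ := hA.exists_subset_closedBall_re_apply_zero (γ := γ)
  have hC : ∀ n, ∀ z ∈ plusDomain (J n), ‖(hJ n).extMap (hJne n) z - z‖ ≤ 12 * r := fun n z hz ↦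
    (hJ n).norm_extMap_sub_self_le (hJne n) hr ((hJsub n).trans hball) hz
  have hfr' : ∀ z ∈ upperHalfPlaneSet ∩ frontier A, ∀ᶠ n in atTop, z ∈ J n := fun z hz ↦
    IsArcHull.eventually_mem_slit hfr hvt hz
  have hker := hAp.tendstoLocallyUniformlyOn_extMap_of_frontier hne hJ hJne hdom hC hfr'
  refine ⟨?_, fun S hS hSH hSF ↦ ⟨?_, ?_⟩⟩
  · obtain ⟨δ, hδ, hAδ⟩ := hAp.1.exists_subset_norm_annulus
    exact ⟨δ, hδ, fun n ↦ (hJsub n).trans hAδ⟩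
  · exact Eventually.of_forall fun n ↦ hSF.mono_right ((hJsub n).trans (subset_realFill A))
  · have hSU : S ⊆ plusDomain A :=
      hA.subset_plusDomain_of_disjoint_realFill hAp hγc hfr hSH hSF
    have hunif := (tendstoLocallyUniformlyOn_iff_forall_isCompact hAp.isOpen_plusDomain).1 hker S hSU hS
    have hmem : ∀ z ∈ S ∩ upperHalfPlaneSet, z ∈ upperHalfPlaneSet \ A := fun z hz ↦
      ⟨hz.2, fun h ↦ Set.disjoint_left.1 hSF hz.1 (subset_realFill A h)⟩
    refine ((hunif.mono inter_subset_left).congr (Eventually.of_forall fun n z hz ↦ ?_)).congr_right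
      fun z hz ↦ ?_
    · exact (hJ n).extMap_of_mem_diff (hJne n) ⟨(hmem z hz).1, fun h ↦ (hmem z hz).2 (hJsub n h)⟩
    · rw [hAp.extMap_of_mem_diff hne (hmem z hz), hAp.eqOn_baseMap hne hΦ (hmem z hz)]

end SlitConvergence

/-! ### The named fact from Loewner's theorem for slits -/

/-- A `+`-hull which is the closed Loewner hull of a continuous driving function with `W_0 > 0`
is an `LSWClosedConverges`-limit of `𝒜₀` (`Loewner.exists_lswClosedConverges_closure_hull`,
transported along the equality of sets). [cite: LawlerSchrammWerner2003Restriction, proof of Lemma 3.5 (p. 13)] -/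
theorem exists_lswClosedConverges_of_closure_hull_eq {X : Set ℂ} (hX : IsPlusHull X)
    {Ψ : ConformalEquiv (upperHalfPlaneSet \ X) upperHalfPlaneSet} (hΨ : IsRestrictionMap X Ψ)
    {W : ℝ≥0 → ℝ} {S : ℝ≥0} (hW : Continuous W) (hS : 0 < S) (hW0 : 0 < W 0)
    (hK : closure (Loewner.hull W S) = X) :
    ∃ (B : ℕ → Set ℂ) (χ : ∀ m, ConformalEquiv (upperHalfPlaneSet \ B m) upperHalfPlaneSet),
      (∀ m, IsLSWGenerated (B m)) ∧ (∀ m, IsRestrictionMap (B m) (χ m)) ∧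
        LSWClosedConverges X Ψ B χ := by
  subst hK
  exact Loewner.exists_lswClosedConverges_closure_hull hW hS hW0 hX hΨ

/-- **The hulls `E_δ` are limits of `𝒜₀`, from Loewner's theorem for slits** ([LSW] proof of
Lemma 3.5, p. 13; Lawler (2005), Prop. 4.4 / Thm. 4.6): if every slit `γ[0, u]` (`γ` continuous
and injective on `[0, u]`, `γ(0) ∈ (0, ∞)`, `γ(0, u] ⊆ ℍ`) is the closed hull `closure (K_S)`,
`S > 0`, of the chordal Loewner chain of some continuous `W` with `W_0 > 0` (hypothesis `hslit`),
then the named fact `IsArcHull.exists_isLSWGenerated_lswClosedConverges` of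
`RestrictionDensityArc` holds: the slits `β[0, 1 - 1/(n+2)]` of the boundary path of `A`
converge to `A` (`IsArcHull.lswClosedConverges_slit`), each is a limit of `𝒜₀`
(`exists_lswClosedConverges_of_closure_hull_eq`), and the diagonal principle applies
(`realFill (β[0, u]) = β[0, u] ⊆ realFill A`). [cite: LawlerSchrammWerner2003Restriction, proof of Lemma 3.5 (p. 13)] -/
theorem IsArcHull.exists_isLSWGenerated_lswClosedConverges_of_slit
    (hslit : ∀ {γ : ℝ → ℂ} {u : ℝ}, 0 < u → ContinuousOn γ (Icc 0 u) → InjOn γ (Icc 0 u) →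
      (γ 0).im = 0 → 0 < (γ 0).re → (∀ t ∈ Ioc 0 u, 0 < (γ t).im) →
      ∃ (W : ℝ≥0 → ℝ) (S : ℝ≥0), Continuous W ∧ 0 < S ∧ 0 < W 0 ∧
        closure (Loewner.hull W S) = γ '' Icc 0 u) :
    IsArcHull.exists_isLSWGenerated_lswClosedConverges := by
  intro A hA hAp Φ hΦ
  obtain ⟨γ, hγc, hγi, h0, -, hH, hfr⟩ := hA.2
  have hne : A.Nonempty := ⟨γ 0, hA.apply_zero_mem hγc hfr⟩
  -- the slits `γ[0, v n]`, `v n = 1 - 1/(n+2) ↑ 1`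
  set v : ℕ → ℝ := fun n ↦ 1 - 1 / ((n : ℝ) + 2) with hv
  have hv0 : ∀ n, 0 < v n := fun n ↦ by
    have h2 : (2 : ℝ) ≤ (n : ℝ) + 2 := by linarith [n.cast_nonneg (α := ℝ)]
    have : 1 / ((n : ℝ) + 2) ≤ 1 / 2 := one_div_le_one_div_of_le two_pos h2
    simp only [hv]; linarith
  have hv1 : ∀ n, v n < 1 := fun n ↦ by
    have : 0 < 1 / ((n : ℝ) + 2) := by positivity
    simp only [hv]; linarith
  have hvt : Tendsto v atTop (𝓝 1) := by
    have h1 : Tendsto (fun n : ℕ ↦ 1 / ((n : ℝ) + 2)) atTop (𝓝 0) := by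
      have h2 : Tendsto (fun n : ℕ ↦ 1 / (((n + 1 : ℕ) : ℝ) + 1)) atTop (𝓝 0) :=
        (tendsto_one_div_add_atTop_nhds_zero_nat (𝕜 := ℝ)).comp (tendsto_add_atTop_nat 1)
      refine h2.congr fun n ↦ ?_
      simp only [Nat.cast_add, Nat.cast_one]
      ring
    have := h1.const_sub 1
    rw [sub_zero] at this
    exact this
  have hJ : ∀ n, IsPlusHull (γ '' Icc 0 (v n)) := fun n ↦
    hA.isPlusHull_slit hAp hγc hγi h0 hH hfr (hv0 n) (hv1 n)
  have hJne : ∀ n, (γ '' Icc 0 (v n)).Nonempty := fun n ↦ (nonempty_Icc.2 (hv0 n).le).image γ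
  -- Step 1: the slits converge to `A`
  have hconv := hA.lswClosedConverges_slit hAp hγc hγi h0 hH hfr hv0 hv1 hvt hΦ
  -- Step 2: each slit is a limit of `𝒜₀`
  have happrox : ∀ n, ∃ (B : ℕ → Set ℂ) (χ : ∀ m, ConformalEquiv (upperHalfPlaneSet \ B m) upperHalfPlaneSet),
      (∀ m, IsLSWGenerated (B m)) ∧ (∀ m, IsRestrictionMap (B m) (χ m)) ∧
        LSWClosedConverges (γ '' Icc 0 (v n)) ((hJ n).baseMap (hJne n)) B χ := by
    intro n
    obtain ⟨W, S, hW, hS, hW0, hK⟩ := hslit (hv0 n) (hγc.mono (Icc_subset_Icc_right (hv1 n).le))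
      (hγi.mono (Icc_subset_Icc_right (hv1 n).le)) h0 (hA.re_apply_zero_pos hAp hγc h0 hfr)
      fun _ ht ↦ IsArcHull.im_pos_of_mem_Ioc hH (hv1 n) ht
    exact exists_lswClosedConverges_of_closure_hull_eq (hJ n) ((hJ n).isRestrictionMap_baseMap (hJne n))
      hW hS hW0 hK
  choose B χ hBgen hχ hBconv using happrox
  -- Step 3: diagonal
  obtain ⟨m, hm⟩ := hAp.exists_lswClosedConverges_diagonal hne
    (fun n ↦ hA.realFill_slit_subset hγc h0 hH hfr (hv0 n).le (hv1 n)) hconv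
    (fun n m ↦ (hBgen n m).isStarHull) hBconv
  exact ⟨fun n ↦ B n (m n), fun n ↦ χ n (m n), fun n ↦ hBgen n (m n), fun n ↦ hχ n (m n), hm⟩

end Literature.Probability.RandomPlanarGeometry
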